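import Mathlib.Data.Real.Basic
import Mathlib.Data.Fintype.Powerset
import Mathlib.Data.Finset.BooleanAlgebra
import Mathlib.Algebra.BigOperators.Ring.Finset
import Mathlib.Algebra.Order.BigOperators.Group.Finset
import Mathlib.Tactic.Linarith
import Mathlib.Tactic.Ring
import HarnessLib

/-!
# Harris' inequality along a decision tree: leaf-averages of increasing functions are positively correlated

Support file (`--supports stmt-CriticalPhenomena-4575`, closed), prover `prim-cplus-coupling` (gen 24).  Memo `prim-cplus-coupling/A5-COUPLING-gen24.md` §1.7.
No definitions of mathematical objects beyond the auxiliary syntax tree `DTree` (a finite binary tree of coordinate queries) and its leaf-averaging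
operator; no named facts, no sorries; standard axioms.

Setting.  The uniform measure on the cube `Finset ι` (`ι` finite; a point `t` is the set of coordinates equal to `1`).  A DECISION TREE queries a coordinate
`e`, branches on `e ∈ t`, and continues with a subtree on each branch; it is well formed (`DTree.wf = true`) if no coordinate is queried twice along a branch.  Its
leaves partition the cube into sub-cubes (cylinders), and `T.avg Y t` is the average of `Y` over the leaf cylinder containing `t` — the conditional expectation
`E[Y | leaf]`, defined here by structural recursion (restrict `Y` to `e = 1` resp. `e = 0` and recurse; at a leaf take the global average).

* `DTree.sum_mul_avg_ge` — **decision-tree Harris inequality**: for a well-formed tree `T` (`T.wf = true`) and monotone `U, Y : Finset ι → ℝ`,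
  `(Σ_t U t)·(Σ_t Y t) ≤ 2^{|ι|} · Σ_t U t · T.avg Y t`, i.e. `E[U · E[Y | leaves]] ≥ E[U]·E[Y]`; equivalently the leaf averages `E[U | leaf]`, `E[Y | leaf]` are
  positively correlated across the leaf partition.  (The trivial tree gives equality; the complete tree gives Harris' inequality itself.)  Proof: induction on the
  tree; at a query the two branch sums are handled by the induction hypothesis and recombined by Chebyshev's sum inequality, exactly as in the textbook proof
  of Harris' inequality — the tree only decides which coordinate is split next.

Use (memo §1.7, 'RP₀'): the exploration of the blue cluster of a vertex `x` in a two-colouring is such a tree whose leaves are the cylinders {blue cluster of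
`x` = `L`}; hence two colourings that share the blue cluster of `x` (and its red frontier) and are independent elsewhere have positively quadrant-dependent red
clusters of `x` — the unconditioned case of the 'replica positivity' conjecture RP of the antipodal-BHK programme.  The instantiation is not formalised here.
[cite: VandenbergHaggstromKahn2005, Thm. 1.3 (p. 6) (context: conditional positive association)]; context [cite: KozmaNitzan2024, §5.5 (p. 36)].
-/

noncomputable section

open Finset
open scoped Classical

namespace Summit.CriticalPhenomena.PercolationContinuityZ3.Theorems

/-- A finite binary decision tree over coordinates `ι`: a leaf, or a query of coordinate `e` with a subtree for `e = 1` (`hi`) and one for `e = 0` (`lo`).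
[this work] -/
inductive DTree (ι : Type*) where
  | leaf : DTree ι
  | node : ι → DTree ι → DTree ι → DTree ι

namespace DTree

variable {ι : Type*} [Fintype ι] [DecidableEq ι]

/-- The coordinates queried somewhere in the tree. [this work] -/
def vars : DTree ι → Finset ι
  | leaf => ∅
  | node e hi lo => insert e (hi.vars ∪ lo.vars)

/-- Well-formedness check (Boolean): no coordinate is queried again below its query. [this work] -/
def wf : DTree ι → Bool
  | leaf => true
  | node e hi lo => decide (e ∉ hi.vars) && decide (e ∉ lo.vars) && hi.wf && lo.wf

/-- The leaf-average operator: `T.avg Y t` = average of `Y` over the leaf cylinder of `t` (uniform measure on the cube). [this work] -/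
def avg : DTree ι → (Finset ι → ℝ) → Finset ι → ℝ
  | leaf, Y => fun _ => (∑ s : Finset ι, Y s) / (Fintype.card (Finset ι) : ℝ)
  | node e hi lo, Y => fun t =>
      if e ∈ t then hi.avg (fun s => Y (insert e s)) t else lo.avg (fun s => Y (s.erase e)) t

/-- A function is `e`-independent if inserting `e` does not change it. [folklore] -/
private def Indep (e : ι) (W : Finset ι → ℝ) : Prop := ∀ s, W (insert e s) = W s

omit [Fintype ι] in
/-- An `e`-independent function is unchanged by erasing `e`. [folklore] -/
private theorem indep_erase {e : ι} {W : Finset ι → ℝ} (hW : Indep e W) (s : Finset ι) : W (s.erase e) = W s := by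
  by_cases h : e ∈ s
  · have := hW (s.erase e)
    rw [insert_erase h] at this
    exact this.symm
  · rw [erase_eq_of_notMem h]

omit [Fintype ι] in
/-- `s ↦ W (insert e s)` is `e`-independent. [folklore] -/
private theorem indep_insert_comp (e : ι) (W : Finset ι → ℝ) : Indep e (fun s => W (insert e s)) :=
  fun s => by simp only [insert_idem]

omit [Fintype ι] in
/-- An `e`-independent function is unchanged by erasing `e`. [folklore] -/
private theorem indep_erase_comp (e : ι) (W : Finset ι → ℝ) : Indep e (fun s => W (s.erase e)) :=
  fun s => by
    simp only
    by_cases h : e ∈ s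
    · rw [insert_eq_of_mem h]
    · rw [erase_insert h, erase_eq_of_notMem h]

/-- The leaf average of an `e`-independent function under a tree not querying `e` is `e`-independent. [this work] -/
private theorem avg_indep {e : ι} : ∀ (T : DTree ι), e ∉ T.vars → ∀ {W : Finset ι → ℝ}, Indep e W → Indep e (T.avg W)
  | leaf, _, W, _ => fun s => rfl
  | node e' hi lo, hT, W, hW => by
    have he' : e ≠ e' := by
      intro h; subst h; simp [vars] at hT
    have hhi : e ∉ hi.vars := fun h => hT (by simp [vars, h])
    have hlo : e ∉ lo.vars := fun h => hT (by simp [vars, h])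
    intro s
    simp only [avg]
    have hmem : (e' ∈ insert e s) ↔ (e' ∈ s) := by
      rw [mem_insert]; exact ⟨fun h => h.resolve_left (Ne.symm he'), Or.inr⟩
    have hW1 : Indep e (fun s => W (insert e' s)) := fun s => by
      simp only; rw [Finset.insert_comm]; exact hW _
    have hW0 : Indep e (fun s => W (s.erase e')) := fun s => by
      simp only; rw [erase_insert_of_ne he']; exact hW _
    by_cases h : e' ∈ s
    · rw [if_pos (hmem.2 h), if_pos h]
      exact avg_indep hi hhi hW1 s
    · rw [if_neg (fun h' => h (hmem.1 h')), if_neg h]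
      exact avg_indep lo hlo hW0 s

/-- For an `e`-independent `H`, the sums over `{t ∋ e}` and `{t ∌ e}` agree. [folklore] -/
private theorem sum_filter_mem_eq {e : ι} {H : Finset ι → ℝ} (hH : Indep e H) :
    ∑ t ∈ univ.filter (fun t : Finset ι => e ∈ t), H t = ∑ t ∈ univ.filter (fun t : Finset ι => e ∉ t), H t := by
  refine Finset.sum_bij' (fun t _ => t.erase e) (fun t _ => insert e t) ?_ ?_ ?_ ?_ ?_
  · intro t _; simp
  · intro t _; simp
  · intro t ht
    have : e ∈ t := by simpa using ht
    exact insert_erase this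
  · intro t ht
    have : e ∉ t := by simpa using ht
    exact erase_insert this
  · intro t _
    exact (indep_erase hH t).symm

/-- For an `e`-independent `H`, `Σ_{t ∋ e} H = ½ Σ_t H`. [folklore] -/
private theorem sum_filter_mem_eq_half {e : ι} {H : Finset ι → ℝ} (hH : Indep e H) :
    ∑ t ∈ univ.filter (fun t : Finset ι => e ∈ t), H t = (∑ t : Finset ι, H t) / 2 := by
  have hsplit := Finset.sum_filter_add_sum_filter_not (univ : Finset (Finset ι)) (fun t : Finset ι => e ∈ t) H
  have heq := sum_filter_mem_eq hH
  linarith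

/-- **Harris' inequality along a decision tree.**  For a well-formed decision tree `T` on the cube `Finset ι` and monotone `U, Y : Finset ι → ℝ`,
`(Σ_t U t)(Σ_t Y t) ≤ 2^{|ι|} Σ_t U t · (T.avg Y) t`: under the uniform measure, `E[U · E[Y | leaves of T]] ≥ E[U] E[Y]`, i.e. the leaf-averages of two
increasing functions are positively correlated.  (Leaves = cylinders of an adaptive coordinate exploration; `T = leaf` gives equality, the complete tree gives
Harris' inequality.) [this work] -/
theorem sum_mul_avg_ge : ∀ (T : DTree ι), T.wf = true → ∀ (U Y : Finset ι → ℝ), Monotone U → Monotone Y →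
    (∑ t : Finset ι, U t) * (∑ t : Finset ι, Y t) ≤ (Fintype.card (Finset ι) : ℝ) * ∑ t : Finset ι, U t * T.avg Y t
  | leaf, _, U, Y, _, _ => by
    have hcard : (0 : ℝ) < (Fintype.card (Finset ι) : ℝ) := by exact_mod_cast Fintype.card_pos
    simp only [avg]
    rw [← Finset.sum_mul]
    have h : (Fintype.card (Finset ι) : ℝ) * ((∑ i : Finset ι, U i) * ((∑ t : Finset ι, Y t) / (Fintype.card (Finset ι) : ℝ)))
        = (∑ i : Finset ι, U i) * (∑ t : Finset ι, Y t) := by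
      rw [mul_comm, mul_assoc, div_mul_cancel₀ _ hcard.ne']
    rw [h]
  | node e hi lo, hT, U, Y, hU, hY => by
    obtain ⟨hehi, helo, hhi, hlo⟩ : e ∉ hi.vars ∧ e ∉ lo.vars ∧ hi.wf = true ∧ lo.wf = true := by
      simp only [wf, Bool.and_eq_true, decide_eq_true_eq] at hT
      exact ⟨hT.1.1.1, hT.1.1.2, hT.1.2, hT.2⟩
    -- restrictions to `e = 1` / `e = 0`
    set U1 : Finset ι → ℝ := fun s => U (insert e s) with hU1
    set U0 : Finset ι → ℝ := fun s => U (s.erase e) with hU0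
    set Y1 : Finset ι → ℝ := fun s => Y (insert e s) with hY1
    set Y0 : Finset ι → ℝ := fun s => Y (s.erase e) with hY0
    have hU1m : Monotone U1 := fun s t hst => hU (insert_subset_insert e hst)
    have hU0m : Monotone U0 := fun s t hst => hU (erase_subset_erase e hst)
    have hY1m : Monotone Y1 := fun s t hst => hY (insert_subset_insert e hst)
    have hY0m : Monotone Y0 := fun s t hst => hY (erase_subset_erase e hst)
    have ih1 := sum_mul_avg_ge hi hhi U1 Y1 hU1m hY1m
    have ih0 := sum_mul_avg_ge lo hlo U0 Y0 hU0m hY0m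
    -- `e`-independence
    have iU1 : Indep e U1 := indep_insert_comp e U
    have iU0 : Indep e U0 := indep_erase_comp e U
    have iY1 : Indep e Y1 := indep_insert_comp e Y
    have iY0 : Indep e Y0 := indep_erase_comp e Y
    have iA1 : Indep e (hi.avg Y1) := avg_indep hi hehi iY1
    have iA0 : Indep e (lo.avg Y0) := avg_indep lo helo iY0
    -- split the main sum at `e`
    set F : Finset (Finset ι) := univ.filter (fun t : Finset ι => e ∈ t) with hF
    set Fc : Finset (Finset ι) := univ.filter (fun t : Finset ι => ¬ e ∈ t) with hFc
    have hsplitA : ∑ t : Finset ι, U t * (node e hi lo).avg Y t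
        = ∑ t ∈ F, U1 t * hi.avg Y1 t + ∑ t ∈ Fc, U0 t * lo.avg Y0 t := by
      rw [← Finset.sum_filter_add_sum_filter_not univ (fun t : Finset ι => e ∈ t)]
      congr 1
      · refine Finset.sum_congr rfl fun t ht => ?_
        have het : e ∈ t := by simpa [hF] using ht
        simp only [avg, hU1]
        rw [if_pos het, insert_eq_of_mem het]
      · refine Finset.sum_congr rfl fun t ht => ?_
        have het : e ∉ t := by simpa [hFc] using ht
        simp only [avg, hU0]
        rw [if_neg het, erase_eq_of_notMem het]
    have iUA1 : Indep e (fun t => U1 t * hi.avg Y1 t) := fun s => by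
      show U1 (insert e s) * hi.avg Y1 (insert e s) = U1 s * hi.avg Y1 s
      rw [iU1 s, iA1 s]
    have iUA0 : Indep e (fun t => U0 t * lo.avg Y0 t) := fun s => by
      show U0 (insert e s) * lo.avg Y0 (insert e s) = U0 s * lo.avg Y0 s
      rw [iU0 s, iA0 s]
    have hA1 : ∑ t ∈ F, U1 t * hi.avg Y1 t = (∑ t : Finset ι, U1 t * hi.avg Y1 t) / 2 := sum_filter_mem_eq_half iUA1
    have hA0 : ∑ t ∈ Fc, U0 t * lo.avg Y0 t = (∑ t : Finset ι, U0 t * lo.avg Y0 t) / 2 := by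
      have h1 := sum_filter_mem_eq_half iUA0
      have h2 := Finset.sum_filter_add_sum_filter_not (univ : Finset (Finset ι)) (fun t : Finset ι => e ∈ t) (fun t => U0 t * lo.avg Y0 t)
      rw [← hF] at h1 h2; rw [← hFc] at h2
      linarith
    -- the plain sums split the same way
    have hsumU : ∑ t : Finset ι, U t = ((∑ t : Finset ι, U1 t) + ∑ t : Finset ι, U0 t) / 2 := by
      rw [← Finset.sum_filter_add_sum_filter_not univ (fun t : Finset ι => e ∈ t)]
      have e1 : ∑ t ∈ univ.filter (fun t : Finset ι => e ∈ t), U t = ∑ t ∈ F, U1 t :=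
        Finset.sum_congr (by rw [hF]) fun t ht => by
          have het : e ∈ t := by simpa [hF] using ht
          simp only [hU1]; rw [insert_eq_of_mem het]
      have e0 : ∑ t ∈ univ.filter (fun t : Finset ι => ¬ e ∈ t), U t = ∑ t ∈ Fc, U0 t :=
        Finset.sum_congr (by rw [hFc]) fun t ht => by
          have het : e ∉ t := by simpa [hFc] using ht
          simp only [hU0]; rw [erase_eq_of_notMem het]
      rw [e1, e0, sum_filter_mem_eq_half iU1]
      have h0 := sum_filter_mem_eq_half iU0
      have h2 := Finset.sum_filter_add_sum_filter_not (univ : Finset (Finset ι)) (fun t : Finset ι => e ∈ t) U0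
      rw [← hF] at h0 h2; rw [← hFc] at h2
      linarith
    have hsumY : ∑ t : Finset ι, Y t = ((∑ t : Finset ι, Y1 t) + ∑ t : Finset ι, Y0 t) / 2 := by
      rw [← Finset.sum_filter_add_sum_filter_not univ (fun t : Finset ι => e ∈ t)]
      have e1 : ∑ t ∈ univ.filter (fun t : Finset ι => e ∈ t), Y t = ∑ t ∈ F, Y1 t :=
        Finset.sum_congr (by rw [hF]) fun t ht => by
          have het : e ∈ t := by simpa [hF] using ht
          simp only [hY1]; rw [insert_eq_of_mem het]
      have e0 : ∑ t ∈ univ.filter (fun t : Finset ι => ¬ e ∈ t), Y t = ∑ t ∈ Fc, Y0 t :=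
        Finset.sum_congr (by rw [hFc]) fun t ht => by
          have het : e ∉ t := by simpa [hFc] using ht
          simp only [hY0]; rw [erase_eq_of_notMem het]
      rw [e1, e0, sum_filter_mem_eq_half iY1]
      have h0 := sum_filter_mem_eq_half iY0
      have h2 := Finset.sum_filter_add_sum_filter_not (univ : Finset (Finset ι)) (fun t : Finset ι => e ∈ t) Y0
      rw [← hF] at h0 h2; rw [← hFc] at h2
      linarith
    -- Chebyshev: the `1`-branch sums dominate the `0`-branch sums
    have hUle : ∑ t : Finset ι, U0 t ≤ ∑ t : Finset ι, U1 t :=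
      Finset.sum_le_sum fun t _ => hU ((erase_subset e t).trans (subset_insert e t))
    have hYle : ∑ t : Finset ι, Y0 t ≤ ∑ t : Finset ι, Y1 t :=
      Finset.sum_le_sum fun t _ => hY ((erase_subset e t).trans (subset_insert e t))
    have hcard : (0 : ℝ) < (Fintype.card (Finset ι) : ℝ) := by exact_mod_cast Fintype.card_pos
    rw [hsplitA, hA1, hA0, hsumU, hsumY]
    nlinarith [ih1, ih0, mul_nonneg (sub_nonneg.2 hUle) (sub_nonneg.2 hYle)]

end DTree

end Summit.CriticalPhenomena.PercolationContinuityZ3.Theorems
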